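import Summits.FinalStateConjecture.FinalStateConjecture.Theorems.BartnikGapSettlingGapExhaustionKerrFamilyScaling
import Summits.FinalStateConjecture.FinalStateConjecture.Theorems.BartnikGapSettlingGapExhaustionKerrBandHigherRegularityUniform
import HarnessLib

/-!
# `KerrFarBandRegularity`: scale-free far-field bounds of the Kerr–Schild family
(crux `GapExhaustion`, stmt-FinalStateConjecture-10808, line photon-shell-pseudoconvexity;
registered stub `stub_kerrFarBandRegularity`, far chain F3 of the scale-covariant far sweep,
lead c12 wave 3)

The far step of the conditional Killing sweep through the Kerr–Schild cylinders `{r = c}` must work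
with ONE closeness tolerance at ALL large radii `c`, against a WEIGHTED closeness hypothesis
`‖Dʲ(Ψ^*g − g_{M,a})‖ ≤ δM/r^{j+1}`. Its exact-Kerr input is therefore scale-free: for labels
`0 < M`, `|a| ≤ χM` (`χ < 1`) and every point `z` of Kerr–Schild coordinate space with
`r_a(z) ≥ R_s M` one needs, with constants depending on nothing,

* `g_{M,a}` and `r_a` are `C^∞` at `z`;
* `ν ≤ ‖Dr_a(z)‖ ≤ C_K`;
* `‖g_{M,a}(z) − η‖ ≤ C_K M / r`, `‖Dʲ g_{M,a}(z)‖ ≤ C_K M / r^{j+1}` and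
  `‖Dʲ r_a(z)‖ ≤ C_K / r^{j−1}` for `1 ≤ j ≤ 6`.

Proof. EXACT DILATION COVARIANCE of the Kerr–Schild family (Kerr–Schild 1965, §2; Visser
arXiv:0706.0622, (32)–(35)): with `λ = r_a(z)` and `y = z/λ`,
`r_a = λ · r_{a/λ} ∘ (λ⁻¹ ·)` and `g_{M,a} − η = (M/λ) · (g_{1,a/λ} − η) ∘ (λ⁻¹ ·)`
(`Kerr.radius_smul`, `Kerr.ksPert_smul`: the perturbation `2Hℓ ⊗ ℓ` is linear in the mass), so by
the chain rule with the dilation (`norm_iteratedFDeriv_const_smul_comp_smul_le`)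
`‖Dʲ(g_{M,a} − η)(z)‖ ≤ (M/λ) λ^{−j} ‖Dʲ(g_{1,a/λ} − η)(y)‖`,
`‖Dʲ r_a(z)‖ ≤ λ · λ^{−j} ‖Dʲ r_{a/λ}(y)‖`, and `Dr_a(z) = Dr_{a/λ}(y)` exactly; the rescaled pair
`(a/λ, y)` lies in the COMPACT set `Q = {|α| ≤ 1/2, y⁰ = 0, r_α(y) = 1}` (after a harmless time
translation, the Kerr–Schild data being stationary), on which all `‖Dʲ(g_{1,α} − η)(y)‖`,
`‖Dʲ r_α(y)‖` are bounded and `‖Dr_α(y)‖` has a positive minimum, by joint smoothness of the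
family in `(α, x)` on `{r > 0}` (`Kerr.contDiffAt_ksPert₂`, `Kerr.contDiffAt_radius₂`, and
`Literature.Analysis.Calculus.contDiffAt_iteratedFDeriv_parametric`) and `dr ≠ 0` off the
horizon of the subextremal label `(|α| + 1/16, α)` (`r₊ < 1 = r`). This is the label-uniform
compactness technique of (UN-2) `stub_kerrBandHigherRegularityU` run down to the Minkowski label.

## References

* R. P. Kerr, A. Schild, *A new class of vacuum solutions of the Einstein field equations* (1965),
  §§2–3. [KerrSchild1965]
* M. Visser, *The Kerr spacetime: a brief introduction*, arXiv:0706.0622, (32)–(35). [arXiv07060622]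
* B. O'Neill, *The geometry of Kerr black holes* (1995), §2.5. [ONeill1995]
* J. Dieudonné, *Foundations of Modern Analysis* (1960), (8.12.6).
-/

noncomputable section

-- instance search through the nested operator types `E4 →L[ℝ] E4 →L[ℝ] E4 →L[ℝ] ℝ`
set_option maxSynthPendingDepth 3

-- D-0017: single-problem summit, `Summit.<S>.<S>.…` by design (cf. lakefile `weak.linter.dupNamespace`).
set_option linter.dupNamespace false

namespace Summit.FinalStateConjecture.FinalStateConjecture.Theorems

open Set Function Metric
open Literature.Geometry.Lorentzian Literature.Geometry.Lorentzian.MetricCoord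
open scoped Manifold ContDiff Topology ENNReal

/-- For `|α| ≤ 1/2` the label `(|α| + 1/16, α)` is subextremal with event horizon inside the unit
Kerr sphere: `r₊ = M + √(M² − α²) < 9/16 + 7/16 = 1` (O'Neill 1995, §2.3). [folklore] -/
theorem kerrFar_rPlus_lt_one {α : ℝ} (hα : |α| ≤ 1 / 2) : Kerr.rPlus (|α| + 1 / 16) α < 1 := by
  have h0 : 0 ≤ |α| := abs_nonneg α
  have hsq : √((|α| + 1 / 16) ^ 2 - α ^ 2) < 7 / 16 := by
    rw [Real.sqrt_lt' (by norm_num), ← sq_abs α]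
    nlinarith
  unfold Kerr.rPlus
  linarith

/-- For `j ≥ 1` the iterated derivatives of `g_{M,a}` are those of the Kerr–Schild perturbation
`g_{M,a} − η` (the Minkowski form is constant; `r > 0` for smoothness). [folklore] -/
theorem kerrFar_iteratedFDeriv_bilin_eq {M a : ℝ} {x : E4} (hx : 0 < Kerr.radius a x) {j : ℕ}
    (hj : j ≠ 0) :
    iteratedFDeriv ℝ j (Kerr.bilin M a) x =
      iteratedFDeriv ℝ j (fun y ↦ Kerr.bilin M a y - Minkowski.bilin) x := by
  have h := iteratedFDeriv_sub_apply (f := Kerr.bilin M a) (g := fun _ : E4 ↦ Minkowski.bilin)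
    (Kerr.contDiffAt_bilin M a hx) contDiffAt_const (i := j)
  rw [iteratedFDeriv_const_of_ne hj, Pi.zero_apply, sub_zero] at h
  exact h.symm

/-- **Exact dilation covariance of the differential of the Kerr–Schild radius**:
`Dr_a(x) = Dr_{a/λ}(x/λ)` for `λ > 0`, the chain rule in `r_a = λ · r_{a/λ} ∘ (λ⁻¹ ·)`
(`Kerr.radius_smul`; Visser arXiv:0706.0622, (35)). [cite: arXiv07060622, (35)] -/
theorem kerrFar_fderiv_radius_eq {a r : ℝ} (hr : 0 < r) (x : E4)
    (hd : DifferentiableAt ℝ (Kerr.radius (r⁻¹ * a)) (r⁻¹ • x)) :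
    fderiv ℝ (Kerr.radius a) x = fderiv ℝ (Kerr.radius (r⁻¹ * a)) (r⁻¹ • x) := by
  have hε : 0 < r⁻¹ := inv_pos.2 hr
  have hfun : Kerr.radius a = fun w ↦ r • Kerr.radius (r⁻¹ * a) (r⁻¹ • w) := by
    funext w
    rw [Kerr.radius_smul hε, smul_eq_mul, ← mul_assoc, mul_inv_cancel₀ hr.ne', one_mul]
  have h1 : HasFDerivAt (fun w : E4 ↦ r⁻¹ • w) (r⁻¹ • ContinuousLinearMap.id ℝ E4) x :=
    (hasFDerivAt_id x).const_smul r⁻¹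
  have h2 : HasFDerivAt (fun w : E4 ↦ r • Kerr.radius (r⁻¹ * a) (r⁻¹ • w))
      (r • (fderiv ℝ (Kerr.radius (r⁻¹ * a)) (r⁻¹ • x)).comp
        (r⁻¹ • ContinuousLinearMap.id ℝ E4)) x :=
    (hd.hasFDerivAt.comp x h1).const_smul r
  rw [hfun, h2.fderiv]
  ext v
  simp [smul_smul, mul_inv_cancel₀ hr.ne']

/-- **Compactness down to the Minkowski label.** On the compact set
`Q = {(α, y) | |α| ≤ 1/2, y⁰ = 0, r_α(y) = 1}` the iterated `y`-derivatives of orders `≤ 6` of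
the perturbation `g_{1,α} − η` and of the radius `r_α` are bounded by one constant and `‖Dr_α(y)‖`
has a positive lower bound: joint smoothness of the Kerr–Schild family in `(α, y)` on `{r > 0}`
(Kerr–Schild 1965, §3; Visser arXiv:0706.0622, (32)–(35)), continuity of parametric iterated
derivatives (Dieudonné 1960, (8.12.6)), and `dr ≠ 0` beyond the horizon `r₊ < 1` of the
subextremal label `(|α| + 1/16, α)` (O'Neill 1995, §2.5). [cite: KerrSchild1965, §3] -/
theorem kerrFar_unit_bounds : ∃ B ν : ℝ, 0 ≤ B ∧ 0 < ν ∧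
    ∀ (α : ℝ) (y : E4), |α| ≤ 1 / 2 → y 0 = 0 → Kerr.radius α y = 1 →
      ν ≤ ‖fderiv ℝ (Kerr.radius α) y‖ ∧ ∀ j : ℕ, j ≤ 6 →
        ‖iteratedFDeriv ℝ j (fun x ↦ Kerr.bilin 1 α x - Minkowski.bilin) y‖ ≤ B ∧
        ‖iteratedFDeriv ℝ j (Kerr.radius α) y‖ ≤ B := by
  -- the radius is jointly continuous in `(α, y)`
  have hradc : Continuous fun q : ℝ × E4 ↦ Kerr.radius q.1 q.2 := by
    unfold Kerr.radius E4.spatialNorm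
    fun_prop
  -- the compact set `Q`
  set Q : Set (ℝ × E4) :=
    ({q | |q.1| ≤ 1 / 2} ∩ {q | q.2 0 = 0}) ∩ {q | Kerr.radius q.1 q.2 = 1} with hQdef
  have hQc : IsClosed Q :=
    ((isClosed_le (continuous_abs.comp continuous_fst) continuous_const).inter
      (isClosed_eq ((E4.dx 0).continuous.comp continuous_snd) continuous_const)).inter
      (isClosed_eq hradc continuous_const)
  have hQK : IsCompact Q := by
    refine ((isCompact_Icc (a := -(1 / 2 : ℝ)) (b := 1 / 2)).prod
      (isCompact_closedBall (0 : E4) 2)).of_isClosed_subset hQc ?_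
    rintro ⟨α, y⟩ ⟨⟨hα, hy0⟩, hr1⟩
    have hα' : |α| ≤ 1 / 2 := hα
    have hy0' : y 0 = 0 := hy0
    have hr1' : Kerr.radius α y = 1 := hr1
    refine mk_mem_prod (abs_le.1 hα') (mem_closedBall_zero_iff.2 ?_)
    have h1 := stub_kerrBandHigherRegularityU_norm_sq_le (a := α) hy0'
    rw [hr1', ← sq_abs α] at h1
    refine (sq_le_sq₀ (norm_nonneg _) zero_le_two).1 ?_
    nlinarith [abs_nonneg α]
  have hQpos : ∀ q ∈ Q, 0 < Kerr.radius q.1 q.2 := fun q hq ↦ by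
    rw [show Kerr.radius q.1 q.2 = 1 from hq.2]
    exact one_pos
  -- joint smoothness of the perturbation and of the radius in `(α, y)` on `Q ⊆ {r > 0}`
  have hFb : ∀ q ∈ Q, ContDiffAt ℝ ∞
      (fun q : ℝ × E4 ↦ Kerr.bilin 1 q.1 q.2 - Minkowski.bilin) q :=
    fun q hq ↦ Kerr.contDiffAt_ksPert₂ (hQpos q hq)
  have hFr : ∀ q ∈ Q, ContDiffAt ℝ ∞ (fun q : ℝ × E4 ↦ Kerr.radius q.1 q.2) q :=
    fun q hq ↦ Kerr.contDiffAt_radius₂ (hQpos q hq)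
  have hcb : ∀ j : ℕ, ContinuousOn (fun q : ℝ × E4 ↦
      iteratedFDeriv ℝ j (fun x ↦ Kerr.bilin 1 q.1 x - Minkowski.bilin) q.2) Q :=
    fun j q hq ↦ (Literature.Analysis.Calculus.contDiffAt_iteratedFDeriv_parametric hFb j q
      hq).continuousAt.continuousWithinAt
  have hcr : ∀ j : ℕ, ContinuousOn
      (fun q : ℝ × E4 ↦ iteratedFDeriv ℝ j (Kerr.radius q.1) q.2) Q :=
    fun j q hq ↦ (Literature.Analysis.Calculus.contDiffAt_iteratedFDeriv_parametric hFr j q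
      hq).continuousAt.continuousWithinAt
  have hc1 : ContinuousOn (fun q : ℝ × E4 ↦ ‖fderiv ℝ (Kerr.radius q.1) q.2‖) Q := by
    have h := (hcr 1).norm
    simp only [norm_iteratedFDeriv_one] at h
    exact h
  -- one bound for all the derivatives of order `≤ 6`, through the continuous sum of their norms
  set Φ : ℝ × E4 → ℝ := fun q ↦ ∑ j ∈ Finset.range 7,
    (‖iteratedFDeriv ℝ j (fun x ↦ Kerr.bilin 1 q.1 x - Minkowski.bilin) q.2‖ +
      ‖iteratedFDeriv ℝ j (Kerr.radius q.1) q.2‖) with hΦ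
  have hΦc : ContinuousOn Φ Q :=
    continuousOn_finsetSum _ fun j _ ↦ (hcb j).norm.add (hcr j).norm
  obtain ⟨C, hC⟩ := hQK.exists_bound_of_continuousOn hΦc
  -- the positive minimum of `‖Dr‖` on `Q` (`dr ≠ 0` beyond `r₊(|α| + 1/16, α) < 1`)
  obtain ⟨ν, hν, hνQ⟩ : ∃ ν : ℝ, 0 < ν ∧ ∀ q ∈ Q, ν ≤ ‖fderiv ℝ (Kerr.radius q.1) q.2‖ := by
    by_cases hne : Q.Nonempty
    · obtain ⟨q₀, hq₀, hmin⟩ := hQK.exists_isMinOn hne hc1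
      have hα₀ : |q₀.1| ≤ 1 / 2 := hq₀.1.1
      refine ⟨‖fderiv ℝ (Kerr.radius q₀.1) q₀.2‖, norm_pos_iff.2
        (stub_kerrBandHigherRegularityU_fderiv_radius_ne_zero (M := |q₀.1| + 1 / 16)
          (by linarith) ?_), fun q hq ↦ hmin hq⟩
      rw [show Kerr.radius q₀.1 q₀.2 = 1 from hq₀.2]
      exact kerrFar_rPlus_lt_one hα₀
    · exact ⟨1, one_pos, fun q hq ↦ absurd ⟨q, hq⟩ hne⟩
  refine ⟨max C 0, ν, le_max_right _ _, hν, fun α y hα hy0 hr1 ↦ ?_⟩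
  have hq : (α, y) ∈ Q := ⟨⟨hα, hy0⟩, hr1⟩
  refine ⟨hνQ (α, y) hq, fun j hj ↦ ?_⟩
  have hjmem : j ∈ Finset.range 7 := Finset.mem_range.2 (by omega)
  have hsum : ‖iteratedFDeriv ℝ j (fun x ↦ Kerr.bilin 1 α x - Minkowski.bilin) y‖ +
      ‖iteratedFDeriv ℝ j (Kerr.radius α) y‖ ≤ Φ (α, y) :=
    Finset.single_le_sum (f := fun j ↦
        ‖iteratedFDeriv ℝ j (fun x ↦ Kerr.bilin 1 α x - Minkowski.bilin) y‖ +
          ‖iteratedFDeriv ℝ j (Kerr.radius α) y‖)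
      (fun i _ ↦ add_nonneg (norm_nonneg _) (norm_nonneg _)) hjmem
  have hΦC : Φ (α, y) ≤ max C 0 :=
    (Real.le_norm_self _).trans ((hC _ hq).trans (le_max_left _ _))
  exact ⟨(le_add_of_nonneg_right (norm_nonneg _)).trans (hsum.trans hΦC),
    (le_add_of_nonneg_left (norm_nonneg _)).trans (hsum.trans hΦC)⟩

/-- **Scaling transfer at a point of the time slice.** For `0 < M`, `|a| ≤ M`, `z⁰ = 0` and
`r = r_a(z) ≥ 2M`: with `y = z/r`, `α = a/r` (so `r_α(y) = 1`, `|α| ≤ 1/2`),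
`Dr_a(z) = Dr_α(y)`, `‖Dʲ(g_{M,a} − η)(z)‖ ≤ (M/r) r^{−j} B` and `‖Dʲ r_a(z)‖ ≤ r · r^{−j} B`
(`1 ≤ j`), by the exact dilation covariance `g_{M,a} − η = (M/r)(g_{1,α} − η) ∘ (r⁻¹ ·)`,
`r_a = r · r_α ∘ (r⁻¹ ·)` (Kerr–Schild 1965, §2; Visser arXiv:0706.0622, (32)–(35)) and the
chain rule with the dilation. [cite: KerrSchild1965, §2] -/
theorem kerrFar_point {B ν M a : ℝ} {z : E4}
    (hQ : ∀ (α : ℝ) (y : E4), |α| ≤ 1 / 2 → y 0 = 0 → Kerr.radius α y = 1 →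
      ν ≤ ‖fderiv ℝ (Kerr.radius α) y‖ ∧ ∀ j : ℕ, j ≤ 6 →
        ‖iteratedFDeriv ℝ j (fun x ↦ Kerr.bilin 1 α x - Minkowski.bilin) y‖ ≤ B ∧
        ‖iteratedFDeriv ℝ j (Kerr.radius α) y‖ ≤ B)
    (hM : 0 < M) (haM : |a| ≤ M) (hz0 : z 0 = 0) (hz : 2 * M ≤ Kerr.radius a z) :
    ν ≤ ‖fderiv ℝ (Kerr.radius a) z‖ ∧ ‖fderiv ℝ (Kerr.radius a) z‖ ≤ B ∧
    (∀ j : ℕ, j ≤ 6 → ‖iteratedFDeriv ℝ j (fun x ↦ Kerr.bilin M a x - Minkowski.bilin) z‖ ≤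
      B * M / Kerr.radius a z ^ (j + 1)) ∧
    (∀ j : ℕ, 1 ≤ j → j ≤ 6 → ‖iteratedFDeriv ℝ j (Kerr.radius a) z‖ ≤
      B / Kerr.radius a z ^ (j - 1)) := by
  obtain ⟨r, hrz⟩ : ∃ r, Kerr.radius a z = r := ⟨_, rfl⟩
  rw [hrz] at hz ⊢
  have hr : 0 < r := by linarith
  have hε : 0 < r⁻¹ := inv_pos.2 hr
  -- the rescaled point `r⁻¹ z` and label `r⁻¹ a`: on the unit Kerr sphere, `|r⁻¹ a| ≤ 1/2`
  have hy0 : (r⁻¹ • z) 0 = 0 := by simp [hz0]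
  have hry : Kerr.radius (r⁻¹ * a) (r⁻¹ • z) = 1 := by
    rw [Kerr.radius_smul hε, hrz, inv_mul_cancel₀ hr.ne']
  have hα : |r⁻¹ * a| ≤ 1 / 2 := by
    rw [abs_mul, abs_of_pos hε, inv_mul_le_iff₀ hr]
    linarith
  have hry0 : 0 < Kerr.radius (r⁻¹ * a) (r⁻¹ • z) := by
    rw [hry]
    exact one_pos
  obtain ⟨hνy, hBy⟩ := hQ _ _ hα hy0 hry
  have hfd : fderiv ℝ (Kerr.radius a) z = fderiv ℝ (Kerr.radius (r⁻¹ * a)) (r⁻¹ • z) :=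
    kerrFar_fderiv_radius_eq hr z
      ((Kerr.contDiffAt_radius hry0 (n := 1)).differentiableAt one_ne_zero)
  refine ⟨hfd ▸ hνy, ?_, fun j hj ↦ ?_, fun j hj1 hj6 ↦ ?_⟩
  · rw [hfd, ← norm_iteratedFDeriv_one]
    exact (hBy 1 (by norm_num)).2
  · -- the perturbation: `g_{M,a} − η = (r⁻¹ M) (g_{1, r⁻¹ a} − η) ∘ (r⁻¹ ·)`
    have hfun : (fun x ↦ Kerr.bilin M a x - Minkowski.bilin) =
        fun x ↦ (r⁻¹ * M) • (Kerr.bilin 1 (r⁻¹ * a) (r⁻¹ • x) - Minkowski.bilin) :=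
      funext fun x ↦ Kerr.ksPert_smul hε M a x
    have hkey := norm_iteratedFDeriv_const_smul_comp_smul_le
      (fun x ↦ Kerr.bilin 1 (r⁻¹ * a) x - Minkowski.bilin) (r⁻¹ * M) hε.ne' z (m := j)
      (Kerr.contDiffAt_ksPert (M := 1) hry0)
    calc ‖iteratedFDeriv ℝ j (fun x ↦ Kerr.bilin M a x - Minkowski.bilin) z‖
        = ‖iteratedFDeriv ℝ j
            (fun x ↦ (r⁻¹ * M) • (Kerr.bilin 1 (r⁻¹ * a) (r⁻¹ • x) - Minkowski.bilin)) z‖ := by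
          rw [hfun]
      _ ≤ |r⁻¹ * M| * |r⁻¹| ^ j *
            ‖iteratedFDeriv ℝ j (fun x ↦ Kerr.bilin 1 (r⁻¹ * a) x - Minkowski.bilin)
              (r⁻¹ • z)‖ := hkey
      _ ≤ r⁻¹ * M * r⁻¹ ^ j * B := by
          rw [abs_of_pos (mul_pos hε hM), abs_of_pos hε]
          exact mul_le_mul_of_nonneg_left (hBy j hj).1 (by positivity)
      _ = B * M / r ^ (j + 1) := by
          rw [inv_pow]
          field_simp
          ring
  · -- the radius: `r_a = r · r_{r⁻¹ a} ∘ (r⁻¹ ·)`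
    obtain ⟨k, rfl⟩ : ∃ k, j = k + 1 := ⟨j - 1, by omega⟩
    have hfun : Kerr.radius a = fun x ↦ r • Kerr.radius (r⁻¹ * a) (r⁻¹ • x) := by
      funext x
      rw [Kerr.radius_smul hε, smul_eq_mul, ← mul_assoc, mul_inv_cancel₀ hr.ne', one_mul]
    have hkey := norm_iteratedFDeriv_const_smul_comp_smul_le (Kerr.radius (r⁻¹ * a)) r hε.ne'
      z (m := k + 1) (Kerr.contDiffAt_radius hry0)
    calc ‖iteratedFDeriv ℝ (k + 1) (Kerr.radius a) z‖
        = ‖iteratedFDeriv ℝ (k + 1) (fun x ↦ r • Kerr.radius (r⁻¹ * a) (r⁻¹ • x)) z‖ := by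
          rw [hfun]
      _ ≤ |r| * |r⁻¹| ^ (k + 1) *
            ‖iteratedFDeriv ℝ (k + 1) (Kerr.radius (r⁻¹ * a)) (r⁻¹ • z)‖ := hkey
      _ ≤ r * r⁻¹ ^ (k + 1) * B := by
          rw [abs_of_pos hr, abs_of_pos hε]
          exact mul_le_mul_of_nonneg_left (hBy (k + 1) hj6).2 (by positivity)
      _ = B / r ^ (k + 1 - 1) := by
          rw [Nat.add_sub_cancel, inv_pow]
          field_simp
          ring

/-- **(F3) Scale-free far-field regularity of the exact Kerr–Schild family** (registered stub
`stub_kerrFarBandRegularity` of line photon-shell-pseudoconvexity, far chain F3; crux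
`GapExhaustion`, stmt-FinalStateConjecture-10808). For every `χ < 1` there are `R_s ≥ 2`,
`C_K ≥ 0`, `ν > 0` such that for all labels `0 < M`, `|a| ≤ χM` and all points `z` with
`r_a(z) ≥ R_s M`: `g_{M,a}` and `r_a` are `C^∞` at `z`, `ν ≤ ‖Dr_a(z)‖ ≤ C_K`,
`‖g_{M,a}(z) − η‖ ≤ C_K M/r`, and `‖Dʲ g_{M,a}(z)‖ ≤ C_K M/r^{j+1}`, `‖Dʲ r_a(z)‖ ≤ C_K/r^{j−1}` for
`1 ≤ j ≤ 6` (in fact `R_s = 2` and `C_K`, `ν` absolute). Exact dilation covariance of the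
Kerr–Schild family, `g_{M,a}(λ·) = g_{M/λ,a/λ}`, `r_a(λ·) = λ r_{a/λ}`, with the perturbation
`2Hℓ ⊗ ℓ` linear in the mass (Kerr–Schild 1965, §2; Visser arXiv:0706.0622, (32)–(35)), reduces
every point to the compact unit Kerr sphere `{r_α(y) = 1, |α| ≤ 1/2, y⁰ = 0}` of the labels down
to Minkowski, where joint smoothness in `(α, y)` on `{r > 0}` (Kerr–Schild 1965, §3) bounds all
derivatives and `dr ≠ 0` (O'Neill 1995, §2.5) bounds `‖Dr‖` below; stationarity removes `z⁰`.
[cite: KerrSchild1965, §2] -/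
theorem stub_kerrFarBandRegularity : ∀ (χ : ℝ), 0 ≤ χ → χ < 1 → ∃ (Rs CK ν : ℝ), 2 ≤ Rs ∧ 0 ≤ CK ∧ 0 < ν ∧ ∀ (M a : ℝ), 0 < M → |a| ≤ χ * M → ∀ z : E4, Rs * M ≤ Kerr.radius a z → ContDiffAt ℝ ∞ (Kerr.bilin M a) z ∧ ContDiffAt ℝ ∞ (Kerr.radius a) z ∧ ν ≤ ‖fderiv ℝ (Kerr.radius a) z‖ ∧ ‖fderiv ℝ (Kerr.radius a) z‖ ≤ CK ∧ ‖Kerr.bilin M a z - Minkowski.bilin‖ ≤ CK * M / Kerr.radius a z ∧ (∀ j : ℕ, 1 ≤ j → j ≤ 6 → ‖iteratedFDeriv ℝ j (Kerr.bilin M a) z‖ ≤ CK * M / Kerr.radius a z ^ (j + 1) ∧ ‖iteratedFDeriv ℝ j (Kerr.radius a) z‖ ≤ CK / Kerr.radius a z ^ (j - 1)) := by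
  intro χ hχ0 hχ1
  obtain ⟨B, ν, hB, hν, hQ⟩ := kerrFar_unit_bounds
  refine ⟨2, B, ν, le_rfl, hB, hν, ?_⟩
  intro M a hM ha z hz
  have haM : |a| ≤ M := ha.trans (mul_le_of_le_one_left hM.le hχ1.le)
  -- stationarity: translate `z` to the time slice `{x⁰ = 0}`
  obtain ⟨z', t, rfl, hz'0⟩ : ∃ (z' : E4) (t : ℝ), z' + t • E4.basisVector 0 = z ∧ z' 0 = 0 :=
    ⟨z + (-(z 0)) • E4.basisVector 0, z 0, by rw [neg_smul, neg_add_cancel_right],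
      by simp [E4.basisVector]⟩
  have hradd : ∀ x : E4, Kerr.radius a (x + t • E4.basisVector 0) = Kerr.radius a x :=
    fun x ↦ Kerr.radius_add_time_smul_basisVector a x t
  have hbT : ∀ x : E4, Kerr.bilin M a (x + t • E4.basisVector 0) = Kerr.bilin M a x :=
    Kerr.bilin_add_time M a t
  have hrT : 0 < Kerr.radius a (z' + t • E4.basisVector 0) := by linarith
  rw [hradd] at hz ⊢
  have hr : 0 < Kerr.radius a z' := by linarith
  obtain ⟨h1, h2, h3, h4⟩ := kerrFar_point hQ hM haM hz'0 hz
  rw [OpensChart.fderiv_eq_of_forall_add_eq hradd z', hbT z']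
  refine ⟨Kerr.contDiffAt_bilin M a hrT, Kerr.contDiffAt_radius hrT, h1, h2, ?_,
    fun j hj1 hj6 ↦ ?_⟩
  · have h := h3 0 (Nat.zero_le _)
    rw [norm_iteratedFDeriv_zero, zero_add, pow_one] at h
    exact h
  · rw [stub_kerrBandHigherRegularityU_iteratedFDeriv_eq_of_forall_add_eq hbT j z',
      stub_kerrBandHigherRegularityU_iteratedFDeriv_eq_of_forall_add_eq hradd j z',
      kerrFar_iteratedFDeriv_bilin_eq hr (j := j) (by omega)]
    exact ⟨h3 j hj6, h4 j hj1 hj6⟩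

end Summit.FinalStateConjecture.FinalStateConjecture.Theorems

end
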